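import Literature.Computability.MetaComplexity.BoundedArithQueriesMu
import Literature.Computability.MetaComplexity.BoundedArithToFormula
import HarnessLib

/-!
# The function symbols of the universal extension of `T₂ⁱ` and their interpretation

Topic `Literature/Computability/MetaComplexity`.  This file sets up the
*language* of the universal conservative extension `U` of Buss's `T₂ᵏ⁺¹` used in the
Herbrand-saturation route to Buss's conservation theorem
(`Literature/Computability/Complexity/BoundedArithmeticHerbrand.lean`, `HerbrandRouteData`), a
`PVₖ₊₂`-style language (Krajíček–Pudlák–Takeuti 1991; Krajíček 1995, §5.3) whose function
symbols denote `Qₖ₊₁`-definable functions (Buss 1990, §3):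

* `QSym k n` — descriptions of `n`-ary function symbols: the symbols of Buss's language,
  projections, composition, renaming of arguments, characteristic functions `χ_θ` of `Σᵇₖ₊₁` /
  `Πᵇₖ₊₁` formulas, least-witness search `μ_{η,t}` for `Σᵇₖ₊₁` formulas `η` below a term `t`
  (Buss 1990, Thm. 12), least zero below a length `lsearch`, and limited iteration with history
  `hist` (Buss 1990, Thm. 11(b));
* `Language.qsym k` — the first-order language with these function symbols and `≤`, the language
  map `qsymι k : Language.boundedArith →ᴸ Language.qsym k`;
* `QSym.eval` — the interpretation of the symbols in a model `M` of `BASIC + Σᵇ₁-IND` by the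
  functions of `BoundedArithQueries{,Iter,Mu}.lean` (`chiFn`, `muFn`, `lsearchFn`, `histFn`),
  the expansion `QSym.expansion M` of `M` to `Language.qsym k` (an expansion along `qsymι`), and
  **`QSym.isQFn_eval`**: in a model of `Σᵇₖ₊₁-IND` every symbol denotes a query-presentable
  (`Qₖ₊₁`-definable) function;
* `QSym.univTheory k` — the universal theory of these expansions of the models of `T₂ᵏ⁺¹`
  (all universal `Language.qsym k`-sentences true in every expansion), with
  `QSym.isUniversal_univTheory` and `QSym.expands_univTheory` (the fields `isUniversal` and
  `expands` of `HerbrandRouteData (k + 1)`).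

The remaining fields of `HerbrandRouteData` (`exists_universal`, `model_S2_succ`) are the
model-theoretic arguments about Herbrand-saturated models of `univTheory k` and are not in this
file.

## References

* S. R. Buss, *Axiomatizations and conservation results for fragments of bounded arithmetic*,
  Contemp. Math. 106, AMS 1990, §3.
* J. Krajíček, *Bounded Arithmetic, Propositional Logic and Complexity Theory*, CUP 1995, §5.3
  (`PVᵢ`), Thm. 5.3.5, §7.6.
* J. Krajíček, P. Pudlák, G. Takeuti, *Bounded arithmetic and the polynomial hierarchy*,
  Ann. Pure Appl. Logic 52 (1991), §1.

## Design choices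

* The universal theory `univTheory k` is defined *semantically* (the universally axiomatised part
  of the theory of the canonical expansions) rather than by a list of axioms: a "fact" usable in a
  model of it is any universal sentence verified in all expansions.  This makes `isUniversal` and
  `expands` immediate and leaves all the work to verifying facts in the expansions, where the
  specifications of `chiFn`, `muFn`, `lsearchFn`, `histFn` are available.
* The expansion is defined for models of `BASIC + Σᵇ₁-IND` (the instance hypotheses under which
  the interpreting functions are defined); `univTheory k` quantifies over the models of
  `Σᵇₖ₊₁-IND` among them, which are exactly the models of `T₂ᵏ⁺¹`.
* `Language.qsym k` lives in `Language.{0, 0}` (symbols in `Type`), as required by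
  `HerbrandRouteData`.
-/

namespace Literature.Computability.MetaComplexity

open FirstOrder FirstOrder.Language

/-! ## The symbols -/

/-- **Descriptions of the function symbols of the universal extension of `T₂ᵏ⁺¹`**: Buss's
symbols, projections, composition `x̄ ↦ g(x̄, h x̄)`, renaming of arguments, definition by
cases `sel a b c d = (if a ≤ b then c else d)`, characteristic functions of `Σᵇₖ₊₁`/`Πᵇₖ₊₁`
formulas (in-context variables, no parameters), least-witness search below a term for a `Σᵇₖ₊₁`
formula, least zero below a length, limited iteration with history and its iterates
`itv g R s (x̄, u₀, j) = u_j` (Buss 1990, §3, Thm. 11(b)), `MSP(b, i) = ⌊b / 2ⁱ⌋`, truncated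
subtraction and sequence decoding `seqEl` (a `PVₖ₊₂`-style signature, Krajíček 1995, §5.3: "closed under definition by cases,
composition and limited recursion").
[cite: BussContempMath1990, §3, Definition of `Qᵢ`-definability] -/
inductive QSym (k : ℕ) : ℕ → Type
  | ba {n : ℕ} (f : BoundedArithFunc n) : QSym k n
  | proj {n : ℕ} (j : Fin n) : QSym k n
  | comp₁ {n : ℕ} (g : QSym k (n + 1)) (h : QSym k n) : QSym k n
  | relabel {n m : ℕ} (g : QSym k n) (e : Fin n → Fin m) : QSym k m
  | sel {n : ℕ} (a b c d : QSym k n) : QSym k n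
  | chi {n : ℕ} (θ : Language.boundedArith.BoundedFormula Empty n)
      (h : IsSigmab (k + 1) θ ∨ IsPib (k + 1) θ) : QSym k n
  | mu {n : ℕ} (η : Language.boundedArith.BoundedFormula Empty (n + 1)) (h : IsSigmab (k + 1) η)
      (t : Language.boundedArith.Term (Empty ⊕ Fin n)) : QSym k n
  | lsearch {n : ℕ} (g : QSym k (n + 1)) (s : Language.boundedArith.Term (Empty ⊕ Fin n)) : QSym k n
  | hist {n : ℕ} (g : QSym k (n + 2)) (R s : Language.boundedArith.Term (Empty ⊕ Fin n)) :
      QSym k (n + 1)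
  | itv {n : ℕ} (g : QSym k (n + 2)) (R s : Language.boundedArith.Term (Empty ⊕ Fin n)) :
      QSym k (n + 2)
  | msp : QSym k 2
  | monus : QSym k 2
  | seqel : QSym k 4

/-- **The language of the universal extension of `T₂ᵏ⁺¹`**: function symbols `QSym k`, the single
relation symbol `≤` (Krajíček 1995, §5.3: the language of `PVᵢ`). Deliberately placed in Mathlib's
`FirstOrder.Language` namespace, following `FirstOrder.Language.boundedArith`.
[cite: Krajicek1995, §5.3] -/
abbrev _root_.FirstOrder.Language.qsym (k : ℕ) : Language :=
  { Functions := QSym k, Relations := BoundedArithRel }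

/-- `Language.qsym k` is an ordered language (its `≤` is `BoundedArithRel.le`). [folklore] -/
instance instIsOrderedQsym (k : ℕ) : (Language.qsym k).IsOrdered := ⟨BoundedArithRel.le⟩

/-- The language map embedding Buss's language into `Language.qsym k` (symbol to symbol).
[folklore] -/
def qsymι (k : ℕ) : Language.boundedArith →ᴸ Language.qsym k :=
  { onFunction := fun {_} f => QSym.ba f, onRelation := fun {_} r => r }

/-! ## Definition by cases -/

namespace BASICModel

variable {k n : ℕ} {M : Type} [Language.boundedArith.Structure M] [hB : M ⊨ BASIC]
  [hI : M ⊨ INDScheme (sigmabFormulas 1)]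

open scoped Classical in
/-- Definition by cases on a comparison: `selFn a b c d = c` if `a ≤ b`, `= d` otherwise
(Krajíček 1995, §5.3: `PVᵢ` is closed under definition by cases). [cite: Krajicek1995, §5.3] -/
noncomputable def selFn (a b c d : M) : M := if a ≤ b then c else d

omit hI in
/-- `selFn a b c d = c` when `a ≤ b`. [folklore] -/
theorem selFn_of_le {a b : M} (h : a ≤ b) (c d : M) : selFn a b c d = c := if_pos h

omit hI in
/-- `selFn a b c d = d` when `b < a`. [folklore] -/
theorem selFn_of_lt {a b : M} (h : b < a) (c d : M) : selFn a b c d = d := if_neg (not_le.2 h)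

omit hI in
/-- The selector is a `Σᵇᵢ`-definable (indeed open-graph) quaternary function. [folklore] -/
theorem isSigmabFn_selFn (i : ℕ) :
    IsSigmabFn i fun w : Fin 4 → M => selFn (w 0) (w 1) (w 2) (w 3) := by
  refine ⟨?_, fun w => w 2 + w 3, (IsTermFn.proj 2).add (IsTermFn.proj 3), fun w => ?_⟩
  · refine ((((IsQFDef.le (IsTermFn.proj 0) (IsTermFn.proj 1)).and
      (IsQFDef.eq (IsTermFn.proj 4) (IsTermFn.proj 2))).or
      ((isQFDef_lt (IsTermFn.proj 1) (IsTermFn.proj 0)).and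
        (IsQFDef.eq (IsTermFn.proj 4) (IsTermFn.proj 3)))).isSigmabDef i).of_iff fun v => ?_
    simp only [graphPred, Fin.init, mLe_iff]
    rcases le_or_gt (v 0) (v 1) with h | h
    · simp [selFn_of_le h, h, not_lt.2 h]
    · simp [selFn_of_lt h, h, not_le.2 h]
  · rw [mLe_iff]
    show selFn (w 0) (w 1) (w 2) (w 3) ≤ w 2 + w 3
    rcases le_or_gt (w 0) (w 1) with h | h
    · rw [selFn_of_le h]; exact le_add_right'' _ _
    · rw [selFn_of_lt h]; exact le_add_left'' _ _

/-- **Composition with a quaternary query-presentable function.** [folklore] -/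
theorem IsQFn.comp₄ (hIk : M ⊨ INDScheme (sigmabFormulas (k + 1))) {S : M → M → M → M → M}
    (hS : IsQFn k fun w : Fin 4 → M => S (w 0) (w 1) (w 2) (w 3)) {A B C D : (Fin n → M) → M}
    (hA : IsQFn k A) (hB' : IsQFn k B) (hC : IsQFn k C) (hD : IsQFn k D) :
    IsQFn k fun x => S (A x) (B x) (C x) (D x) := by
  have hS' : IsQFn k fun u : Fin (n + 4) → M =>
      S (u (Fin.last n).castSucc.castSucc.castSucc) (u (Fin.last (n + 1)).castSucc.castSucc)
        (u (Fin.last (n + 2)).castSucc) (u (Fin.last (n + 3))) :=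
    (hS.relabel (![(Fin.last n).castSucc.castSucc.castSucc, (Fin.last (n + 1)).castSucc.castSucc,
      (Fin.last (n + 2)).castSucc, Fin.last (n + 3)] : Fin 4 → Fin (n + 4))).of_eq fun u => by simp
  have hD3 : IsQFn k fun u : Fin (n + 3) → M => D (Fin.init (Fin.init (Fin.init u))) :=
    ((hD.relabel Fin.castSucc).relabel Fin.castSucc).relabel Fin.castSucc
  have hC2 : IsQFn k fun u : Fin (n + 2) → M => C (Fin.init (Fin.init u)) :=
    (hC.relabel Fin.castSucc).relabel Fin.castSucc
  have hB1 : IsQFn k fun u : Fin (n + 1) → M => B (Fin.init u) := hB'.relabel Fin.castSucc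
  have h := (((hS'.comp₁ hIk hD3).comp₁ hIk hC2).comp₁ hIk hB1).comp₁ hIk hA
  refine h.of_eq fun x => ?_
  simp [Fin.init_snoc, Fin.snoc_castSucc, Fin.snoc_last]

/-- **Definition by cases preserves query-presentability**: `x̄ ↦ selFn (A x̄) (B x̄) (C x̄) (D x̄)`
(in a model of `Σᵇₖ₊₁-IND`). [cite: Krajicek1995, §5.3] -/
theorem IsQFn.sel (hIk : M ⊨ INDScheme (sigmabFormulas (k + 1))) {A B C D : (Fin n → M) → M}
    (hA : IsQFn k A) (hB' : IsQFn k B) (hC : IsQFn k C) (hD : IsQFn k D) :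
    IsQFn k fun x => selFn (A x) (B x) (C x) (D x) :=
  IsQFn.comp₄ hIk ((isSigmabFn_selFn (k + 1)).isQFn) hA hB' hC hD

/-- `MSP(b, i) = ⌊b / 2ⁱ⌋` (with the length-bounded power `pow2B b i = 2^{min(i, |b|)}`, which gives
the same quotient). [cite: Buss1986, §2.4] -/
noncomputable def mspFn (b i : M) : M := b / pow2B b i

/-- `MSP` is query-presentable (indeed `Σᵇ₁`-definable). [folklore] -/
theorem isQFn_mspFn : IsQFn k fun v : Fin 2 → M => mspFn (v 0) (v 1) :=
  (((isSigmabFn_div_pow2B (M := M)).comp (![0, 0, 1] : Fin 3 → Fin 2)).mono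
    (Nat.le_add_left 1 k)).isQFn.of_eq fun v => by simp [mspFn]

/-- Truncated subtraction is query-presentable (indeed `Σᵇ₁`-definable). [folklore] -/
theorem isQFn_monus : IsQFn k fun v : Fin 2 → M => v 0 - v 1 :=
  ((isSigmabFn_of_isTermFn (IsTermFn.proj 0) (k + 1)).sub₂
    (isSigmabFn_of_isTermFn (IsTermFn.proj 1) (k + 1))).isQFn

/-- **The iterates** `itvFn G R s (x̄, u₀, j) = u_j` of the truncated iteration coded by
`histFn G R s (x̄, u₀)`: its digit `j`. [cite: BussContempMath1990, Thm. 11(b)] -/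
noncomputable def itvFn (G : (Fin (n + 2) → M) → M) (R s : (Fin n → M) → M)
    (V : Fin (n + 2) → M) : M :=
  seqEl (itBound (histR R) (histS s) (Fin.init V)) (itWidth (histR R) (Fin.init V))
    (histFn G R s (Fin.init V)) (V (Fin.last (n + 1)))

/-- The iterates of a query-presentable function are query-presentable. [folklore] -/
theorem IsQFn.itvFn (hIk : M ⊨ INDScheme (sigmabFormulas (k + 1))) {G : (Fin (n + 2) → M) → M}
    (hG : IsQFn k G) {R s : (Fin n → M) → M} (hR : IsTermFn R) (hs : IsTermFn s) :
    IsQFn k (itvFn G R s) := by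
  have hS : IsQFn k fun w : Fin 4 → M => seqEl (w 0) (w 1) (w 2) (w 3) :=
    ((isSigmabFn_seqEl (M := M)).mono (Nat.le_add_left 1 k)).isQFn
  have hA : IsTermFn fun V : Fin (n + 2) → M => itBound (histR R) (histS s) (Fin.init V) :=
    ((isTermFn_add_one (isTermFn_two_mul (isTermFn_init (isTermFn_init hs)))).smash
      (isTermFn_add_one (isTermFn_two_mul (isTermFn_init (QPres.isTermFn_histR hR))))).of_eq
      fun _ => rfl
  have hB : IsTermFn fun V : Fin (n + 2) → M => itWidth (histR R) (Fin.init V) :=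
    (isTermFn_init (QPres.isTermFn_histR hR)).len
  have hC : IsQFn k fun V : Fin (n + 2) → M => BASICModel.histFn G R s (Fin.init V) :=
    (hG.histFn hIk hR hs).relabel Fin.castSucc
  exact (IsQFn.comp₄ hIk hS hA.isQFn hB.isQFn hC (IsTermFn.proj (Fin.last (n + 1))).isQFn).of_eq
    fun V => rfl

end BASICModel

/-! ## Interpretation in a model of `BASIC + Σᵇ₁-IND` -/

namespace QSym

open BASICModel

variable {k : ℕ} {M : Type} [Language.boundedArith.Structure M] [hB : M ⊨ BASIC]
  [hI : M ⊨ INDScheme (sigmabFormulas 1)]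

/-- **The interpretation of the symbols** in a model of `BASIC + Σᵇ₁-IND`: by the functions of
Buss's language, projections, composition, renaming, `chiFn`, `muFn`, `lsearchFn`, `histFn`.
[folklore] -/
noncomputable def eval : {n : ℕ} → QSym k n → (Fin n → M) → M
  | _, ba f => fun v => Structure.funMap (L := Language.boundedArith) f v
  | _, proj j => fun v => v j
  | _, comp₁ g h => fun v => eval g (Fin.snoc v (eval h v))
  | _, relabel g e => fun v => eval g (v ∘ e)
  | _, sel a b c d => fun v => selFn (eval a v) (eval b v) (eval c v) (eval d v)
  | _, chi θ _ => chiFn fun v => θ.Realize default v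
  | _, mu η _ t => muFn (fun v => η.Realize default v) fun x => t.realize (Sum.elim default x)
  | _, lsearch g s => lsearchFn (eval g) fun x => s.realize (Sum.elim default x)
  | _, hist g R s => histFn (eval g) (fun x => R.realize (Sum.elim default x))
      fun x => s.realize (Sum.elim default x)
  | _, itv g R s => itvFn (eval g) (fun x => R.realize (Sum.elim default x))
      fun x => s.realize (Sum.elim default x)
  | _, msp => fun v => mspFn (v 0) (v 1)
  | _, monus => fun v => v 0 - v 1
  | _, seqel => fun v => seqEl (v 0) (v 1) (v 2) (v 3)

section EvalEqns

variable {n m : ℕ}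

/-- Interpretation of a symbol of Buss's language. [folklore] -/
@[simp] theorem eval_ba (f : BoundedArithFunc n) (v : Fin n → M) :
    eval (k := k) (ba f) v = Structure.funMap (L := Language.boundedArith) f v := by
  simp only [eval]

/-- Interpretation of a projection. [folklore] -/
@[simp] theorem eval_proj (j : Fin n) (v : Fin n → M) : eval (k := k) (proj j) v = v j := by
  simp only [eval]

/-- Interpretation of a composition. [folklore] -/
@[simp] theorem eval_comp₁ (g : QSym k (n + 1)) (h : QSym k n) (v : Fin n → M) :
    eval (M := M) (comp₁ g h) v = eval g (Fin.snoc v (eval h v)) := by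
  simp only [eval]

/-- Interpretation of a renaming. [folklore] -/
@[simp] theorem eval_relabel (g : QSym k n) (e : Fin n → Fin m) (v : Fin m → M) :
    eval (M := M) (relabel g e) v = eval g (v ∘ e) := by
  simp only [eval]

/-- Interpretation of a selector. [folklore] -/
@[simp] theorem eval_sel (a b c d : QSym k n) (v : Fin n → M) :
    eval (M := M) (sel a b c d) v = selFn (eval a v) (eval b v) (eval c v) (eval d v) := by
  simp only [eval]

/-- Interpretation of a characteristic-function symbol. [folklore] -/
@[simp] theorem eval_chi (θ : Language.boundedArith.BoundedFormula Empty n)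
    (h : IsSigmab (k + 1) θ ∨ IsPib (k + 1) θ) :
    eval (M := M) (chi θ h) = chiFn fun v => θ.Realize default v := by
  funext v; simp only [eval]

/-- Interpretation of a least-witness symbol. [folklore] -/
@[simp] theorem eval_mu (η : Language.boundedArith.BoundedFormula Empty (n + 1))
    (h : IsSigmab (k + 1) η) (t : Language.boundedArith.Term (Empty ⊕ Fin n)) :
    eval (M := M) (mu η h t) =
      muFn (fun v => η.Realize default v) fun x => t.realize (Sum.elim default x) := by
  funext v; simp only [eval]

/-- Interpretation of a least-zero symbol. [folklore] -/
@[simp] theorem eval_lsearch (g : QSym k (n + 1)) (s : Language.boundedArith.Term (Empty ⊕ Fin n)) :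
    eval (M := M) (lsearch g s) = lsearchFn (eval g) fun x => s.realize (Sum.elim default x) := by
  funext v; simp only [eval]

/-- Interpretation of an iteration symbol. [folklore] -/
@[simp] theorem eval_hist (g : QSym k (n + 2)) (R s : Language.boundedArith.Term (Empty ⊕ Fin n)) :
    eval (M := M) (hist g R s) = histFn (eval g) (fun x => R.realize (Sum.elim default x))
      fun x => s.realize (Sum.elim default x) := by
  funext v; simp only [eval]

/-- Interpretation of an iterate symbol. [folklore] -/
@[simp] theorem eval_itv (g : QSym k (n + 2)) (R s : Language.boundedArith.Term (Empty ⊕ Fin n)) :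
    eval (M := M) (itv g R s) = itvFn (eval g) (fun x => R.realize (Sum.elim default x))
      fun x => s.realize (Sum.elim default x) := by
  funext v; simp only [eval]

/-- Interpretation of `msp`. [folklore] -/
@[simp] theorem eval_msp (v : Fin 2 → M) : eval (k := k) msp v = mspFn (v 0) (v 1) := by
  simp only [eval]

/-- Interpretation of `monus`. [folklore] -/
@[simp] theorem eval_monus (v : Fin 2 → M) : eval (k := k) monus v = v 0 - v 1 := by
  simp only [eval]

/-- Interpretation of `seqel`. [folklore] -/
@[simp] theorem eval_seqel (v : Fin 4 → M) :
    eval (k := k) seqel v = seqEl (v 0) (v 1) (v 2) (v 3) := by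
  simp only [eval]

end EvalEqns

omit hB hI in
/-- The interpretation of a symbol of Buss's language is a term function. [folklore] -/
theorem isTermFn_funMap {n : ℕ} (f : BoundedArithFunc n) :
    IsTermFn fun v : Fin n → M => Structure.funMap (L := Language.boundedArith) f v :=
  ⟨Term.func f fun i => Term.var (Sum.inr i), fun v => by simp⟩

/-- **Every symbol denotes a query-presentable function** (`Qₖ₊₁`-definable; in a model of
`BASIC + Σᵇ₁-IND + Σᵇₖ₊₁-IND`), by the closure properties of `BoundedArithQueries{,Iter,Mu}`
(Buss 1990, Cor. 10, Thm. 11, Thm. 12). [cite: BussContempMath1990, Thm. 11] -/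
theorem isQFn_eval (hIk : M ⊨ INDScheme (sigmabFormulas (k + 1))) :
    ∀ {n : ℕ} (s : QSym k n), IsQFn k (eval (M := M) s)
  | _, ba f => (isTermFn_funMap f).isQFn.of_eq fun v => (eval_ba f v).symm
  | _, proj j => (IsTermFn.proj j).isQFn.of_eq fun v => (eval_proj j v).symm
  | _, comp₁ g h => ((isQFn_eval hIk g).comp₁ hIk (isQFn_eval hIk h)).of_eq fun v =>
      (eval_comp₁ g h v).symm
  | _, relabel g e => ((isQFn_eval hIk g).relabel e).of_eq fun v => (eval_relabel g e v).symm
  | _, sel a b c d => ((isQFn_eval hIk a).sel hIk (isQFn_eval hIk b) (isQFn_eval hIk c)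
      (isQFn_eval hIk d)).of_eq fun v => (eval_sel a b c d v).symm
  | _, chi θ h => by
    rw [eval_chi]
    rcases h with h | h
    · exact isQFn_chiFn h.isSigmabDef_realize
    · exact isQFn_chiFn_of_isPibDef h.isPibDef_realize
  | _, mu η h t => by
    rw [eval_mu]
    exact IsQFn.muFn hIk h.isSigmabDef_realize (isTermFn_realize t)
  | _, lsearch g s => by
    rw [eval_lsearch]
    exact (isQFn_eval hIk g).lsearchFn hIk (isTermFn_realize s)
  | _, hist g R s => by
    rw [eval_hist]
    exact (isQFn_eval hIk g).histFn hIk (isTermFn_realize R) (isTermFn_realize s)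
  | _, itv g R s => by
    rw [eval_itv]
    exact (isQFn_eval hIk g).itvFn hIk (isTermFn_realize R) (isTermFn_realize s)
  | _, msp => isQFn_mspFn.of_eq fun v => (eval_msp v).symm
  | _, monus => isQFn_monus.of_eq fun v => (eval_monus v).symm
  | _, seqel => ((isSigmabFn_seqEl (M := M)).mono (Nat.le_add_left 1 k)).isQFn.of_eq fun v =>
      (eval_seqel v).symm

variable (M) in
/-- **The expansion** of a model of `BASIC + Σᵇ₁-IND` to `Language.qsym k`: symbols by `eval`,
`≤` as in `M`. [folklore] -/
@[reducible] noncomputable def expansion (k : ℕ) : (Language.qsym k).Structure M where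
  funMap := fun s v => eval s v
  RelMap := fun r v => Structure.RelMap (L := Language.boundedArith) r v

/-- The expansion is an expansion along `qsymι`: Buss's symbols keep their interpretation.
[folklore] -/
theorem isExpansionOn_expansion (k : ℕ) :
    @LHom.IsExpansionOn _ _ (qsymι k) M _ (expansion M k) := by
  letI := expansion M k
  refine ⟨fun f x => ?_, fun _ _ => rfl⟩
  show eval (ba f) x = _
  exact eval_ba f x


/-! ## Every term is a symbol -/

section TermSym

variable {m : ℕ}

/-- Plugging `l` symbols (reading the first `m` arguments) into the last `l` argument places of a
symbol of arity `m + l`. [folklore] -/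
def plug : (l : ℕ) → QSym k (m + l) → (Fin l → QSym k m) → QSym k m
  | 0, g, _ => g
  | l + 1, g, as => plug l (comp₁ g (relabel (as (Fin.last l)) (Fin.castAdd l)))
      fun i => as (Fin.castSucc i)

/-- **Every term of `Language.qsym k` in the variables `Fin m` is (the interpretation of) a
symbol**: variables are projections, and `f(t₀,…,t_{l-1})` plugs the symbols of the `tᵢ` into
`f`. [folklore] -/
def termSym : (Language.qsym k).Term (Fin m) → QSym k m
  | Term.var i => proj i
  | Term.func (l := l) f ts => plug l (relabel f (Fin.natAdd m)) fun i => termSym (ts i)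

/-- Semantics of `plug`: the plugged symbols are evaluated and appended to the arguments.
[folklore] -/
theorem eval_plug : ∀ (l : ℕ) (g : QSym k (m + l)) (as : Fin l → QSym k m) (v : Fin m → M),
    eval (plug l g as) v = eval g (Fin.append v fun i => eval (as i) v)
  | 0, g, as, v => by
    rw [plug]
    congr 1
    funext i
    have hi : i = Fin.castAdd 0 (Fin.cast (Nat.add_zero m) i) := Fin.ext rfl
    conv_rhs => rw [hi, Fin.append_left]
    rfl
  | l + 1, g, as, v => by
    rw [plug, eval_plug l, eval_comp₁, eval_relabel]
    have e1 : (Fin.append v fun i => eval (as (Fin.castSucc i)) v) ∘ Fin.castAdd l = v := by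
      funext i; simp
    rw [e1]
    congr 1
    have e2 : (fun i => eval (as i) v) = Fin.snoc (fun i => eval (as (Fin.castSucc i)) v)
        (eval (as (Fin.last l)) v) := by
      funext i
      cases i using Fin.lastCases with
      | last => simp
      | cast i => simp
    rw [e2, Fin.append_snoc]

/-- **Semantics of `termSym`** (in the expansion of `M`): the symbol of a term evaluates as the
term. [folklore] -/
theorem eval_termSym : ∀ (t : (Language.qsym k).Term (Fin m)) (v : Fin m → M),
    eval (termSym t) v = @Term.realize _ M (expansion M k) _ v t
  | Term.var i, v => by simp [termSym]
  | Term.func f ts, v => by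
    rw [termSym, eval_plug, eval_relabel]
    letI := expansion M k
    simp only [Term.realize]
    have e : ((Fin.append v fun i => eval (termSym (ts i)) v) ∘ Fin.natAdd m) =
        fun i => Term.realize v (ts i) := by
      funext i
      simp only [Function.comp_apply, Fin.append_right]
      exact eval_termSym (ts i) v
    rw [e]
    rfl

end TermSym

/-! ## The universal theory of the expansions -/

variable (k)

/-- **The universal theory of the canonical expansions of the models of `T₂ᵏ⁺¹`**: all universal
`Language.qsym k`-sentences true in the expansion of every model of
`BASIC + Σᵇ₁-IND + Σᵇₖ₊₁-IND` (= `T₂ᵏ⁺¹`).  This is the universal theory `U` of the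
Herbrand-saturation route (cf. Krajíček 1995, §5.3: `PVₖ₊₂`, a universal axiomatisation of a
conservative extension of `T₂ᵏ⁺¹`; here the strongest such theory in the given language).
[cite: Krajicek1995, §5.3] -/
def univTheory : (Language.qsym k).Theory :=
  {σ | BoundedFormula.IsUniversal σ ∧
    ∀ (N : Type) [Language.boundedArith.Structure N] [N ⊨ BASIC]
      [N ⊨ INDScheme (sigmabFormulas 1)], N ⊨ INDScheme (sigmabFormulas (k + 1)) →
        @Sentence.Realize _ N (expansion N k) σ}

/-- `univTheory k` is a universal theory. [folklore] -/
instance isUniversal_univTheory : (univTheory k).IsUniversal := ⟨fun _ h => h.1⟩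

variable {k}

/-- A universal sentence true in all expansions belongs to `univTheory k`. [folklore] -/
theorem mem_univTheory {σ : (Language.qsym k).Sentence} (hU : BoundedFormula.IsUniversal σ)
    (h : ∀ (N : Type) [Language.boundedArith.Structure N] [N ⊨ BASIC]
      [N ⊨ INDScheme (sigmabFormulas 1)], N ⊨ INDScheme (sigmabFormulas (k + 1)) →
        @Sentence.Realize _ N (expansion N k) σ) : σ ∈ univTheory k := ⟨hU, h⟩

/-- The expansion of a model of `BASIC + Σᵇ₁-IND + Σᵇₖ₊₁-IND` is a model of `univTheory k`.
[folklore] -/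
theorem model_univTheory (hIk : M ⊨ INDScheme (sigmabFormulas (k + 1))) :
    @Theory.Model _ M (expansion M k) (univTheory k) := by
  letI := expansion M k
  exact ⟨fun σ hσ => hσ.2 M hIk⟩

/-- **Every model of `T₂ᵏ⁺¹` expands to a model of `univTheory k`** (the field `expands` of
`HerbrandRouteData (k + 1)`). [folklore] -/
theorem expands_univTheory (N : Type) [Language.boundedArith.Structure N] (hN : N ⊨ T2 (k + 1)) :
    ∃ s : (Language.qsym k).Structure N, @LHom.IsExpansionOn _ _ (qsymι k) N _ s ∧
      @Theory.Model (Language.qsym k) N s (univTheory k) := by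
  haveI : N ⊨ BASIC := hN.mono (BASIC_subset_T2 _)
  have hIk : N ⊨ INDScheme (sigmabFormulas (k + 1)) := hN.mono Set.subset_union_right
  haveI : N ⊨ INDScheme (sigmabFormulas 1) := model_INDScheme_one_of_level hIk
  exact ⟨expansion N k, isExpansionOn_expansion k, model_univTheory hIk⟩

end QSym

end Literature.Computability.MetaComplexity
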